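import Literature.Analysis.FluidPDE.Seregin2020BlowupLimitAlong
import HarnessLib

/-!
# Compactness of a SEQUENCE of local energy ancient solutions, II: gluing the level limits
# (tool for stub Z4 `stub_caseOneZoom` of the line `radius_dichotomy`, item `TerminalTrace.TypeITraceScarL3`,
# stmt-NavierStokesRegularity-18385)

Seat nsreg-C26-p1 g5 (cell ns-regularity-ideate), `--supports stmt-NavierStokesRegularity-18385`.

Second half of the sequence version of Seregin 2014, Prop. 6.20 (first half: `exists_seqLevels`,
`…SeqCompactnessLevels.lean`): VERBATIM steps (C)–(D) of the tree's `exists_zoom_blowup_limit_along` — the level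
limits `(w_m, π_m)` on `Q(2ᵐ R)` of one sequence `(V_j, Π_j)` agree a.e. on overlaps (uniqueness of strong `L³` /
weak `L^{3/2}` limits) and glue along the exhaustion `Q(2ᵐ/2)` to a pair `(w, π)` which, on every `Q_a(0)`, is a
suitable weak solution, the strong `L³` limit of the `V_j` and the weak `L^{3/2}` limit of the `Π_j`
(`glue_seqLevels`).
WHAT THIS IS NOT: 18385 / NS regularity NOT proved. [cite: Seregin2014, §6.6 Prop. 6.20]
-/

noncomputable section

set_option linter.dupNamespace false

namespace Summit.NavierStokesRegularity.NavierStokesRegularity.Theorems.TypeITraceScarL3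

open MeasureTheory Set Function Filter Topology TopologicalSpace Metric
open Literature.Analysis.FluidPDE
open scoped NNReal ENNReal

set_option maxHeartbeats 1600000 in
/-- **Gluing the level limits of a sequence** (Seregin 2014, Prop. 6.20, gluing step, for a SEQUENCE): if the pairs
`(V_j, Π_j)` (`V_j` a.e. strongly measurable on every `Q_a(0)`) have, for every level `m`, a level limit
`(w_m, π_m)` — suitable in `Q(2ᵐ R)` for `0 < R < 1`, `w_m ∈ L³`, `π_m ∈ L^{3/2}`, `V_j → w_m` in `L³(Q(2ᵐ R))`,
`∫ Π_j g → ∫ π_m g` for `g ∈ L³(Q(2ᵐ R))` — then there is ONE pair `(w, π)` with these properties on every `Q_a(0)`,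
`a > 0`. Proof: verbatim steps (C)–(D) of the tree's `exists_zoom_blowup_limit_along`. [cite: Seregin2014, §6.6 Prop. 6.20] -/
theorem glue_seqLevels
    {V : ℕ → ℝ → EuclideanSpace ℝ (Fin 3) → EuclideanSpace ℝ (Fin 3)} {Pj : ℕ → ℝ → EuclideanSpace ℝ (Fin 3) → ℝ}
    (hVm : ∀ j (a : ℝ), 0 < a → AEStronglyMeasurable (uncurry (V j))
      (volume.restrict (parabolicCylinder a (0 : ℝ × EuclideanSpace ℝ (Fin 3)))))
    {wl : ℕ → ℝ → EuclideanSpace ℝ (Fin 3) → EuclideanSpace ℝ (Fin 3)} {πl : ℕ → ℝ → EuclideanSpace ℝ (Fin 3) → ℝ}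
    (hlev : ∀ m : ℕ, ∀ R ∈ Ioo (0 : ℝ) 1,
        IsSuitableWeakSolutionInBall ((2 : ℝ) ^ m * R) 0 (wl m) (πl m) ∧
        MemLp (uncurry (wl m)) 3
          (volume.restrict (parabolicCylinder ((2 : ℝ) ^ m * R) (0 : ℝ × EuclideanSpace ℝ (Fin 3)))) ∧
        MemLp (uncurry (πl m)) (3 / 2)
          (volume.restrict (parabolicCylinder ((2 : ℝ) ^ m * R) (0 : ℝ × EuclideanSpace ℝ (Fin 3)))) ∧
        Tendsto (fun j => eLpNorm (uncurry (V j) - uncurry (wl m)) 3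
            (volume.restrict (parabolicCylinder ((2 : ℝ) ^ m * R) (0 : ℝ × EuclideanSpace ℝ (Fin 3)))))
          atTop (𝓝 0) ∧
        ∀ g : ℝ × EuclideanSpace ℝ (Fin 3) → ℝ,
          MemLp g 3 (volume.restrict (parabolicCylinder ((2 : ℝ) ^ m * R) (0 : ℝ × EuclideanSpace ℝ (Fin 3)))) →
          Tendsto (fun j => ∫ w in parabolicCylinder ((2 : ℝ) ^ m * R) (0 : ℝ × EuclideanSpace ℝ (Fin 3)),
              (Pj j) w.1 w.2 * g w) atTop
            (𝓝 (∫ w in parabolicCylinder ((2 : ℝ) ^ m * R) (0 : ℝ × EuclideanSpace ℝ (Fin 3)),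
              (πl m) w.1 w.2 * g w))) :
    ∃ (w : ℝ → EuclideanSpace ℝ (Fin 3) → EuclideanSpace ℝ (Fin 3)) (π : ℝ → EuclideanSpace ℝ (Fin 3) → ℝ),
      ∀ a : ℝ, 0 < a →
        IsSuitableWeakSolutionInBall a 0 w π ∧
        MemLp (uncurry w) 3
          (volume.restrict (parabolicCylinder a (0 : ℝ × EuclideanSpace ℝ (Fin 3)))) ∧
        Tendsto (fun j => eLpNorm (uncurry (V j) - uncurry w) 3
            (volume.restrict (parabolicCylinder a (0 : ℝ × EuclideanSpace ℝ (Fin 3)))))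
          atTop (𝓝 0) ∧
        ∀ g : ℝ × EuclideanSpace ℝ (Fin 3) → ℝ,
          MemLp g 3 (volume.restrict (parabolicCylinder a (0 : ℝ × EuclideanSpace ℝ (Fin 3)))) →
          Tendsto (fun j => ∫ w' in parabolicCylinder a (0 : ℝ × EuclideanSpace ℝ (Fin 3)),
              (Pj j) w'.1 w'.2 * g w') atTop
            (𝓝 (∫ w' in parabolicCylinder a (0 : ℝ × EuclideanSpace ℝ (Fin 3)), π w'.1 w'.2 * g w')) := by
  classical
  set cc : ℕ → ℝ := fun m => (2 : ℝ) ^ m with hcc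
  have hcc_pos : ∀ m, 0 < cc m := fun m => by positivity
  have hlev' : ∀ m : ℕ, ∀ R ∈ Ioo (0 : ℝ) 1,
      IsSuitableWeakSolutionInBall (cc m * R) 0 (wl m) (πl m) ∧
      MemLp (uncurry (wl m)) 3
        (volume.restrict (parabolicCylinder (cc m * R) (0 : ℝ × EuclideanSpace ℝ (Fin 3)))) ∧
      MemLp (uncurry (πl m)) (3 / 2)
        (volume.restrict (parabolicCylinder (cc m * R) (0 : ℝ × EuclideanSpace ℝ (Fin 3)))) ∧
      Tendsto (fun j => eLpNorm (uncurry (V j) - uncurry (wl m)) 3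
          (volume.restrict (parabolicCylinder (cc m * R) (0 : ℝ × EuclideanSpace ℝ (Fin 3)))))
        atTop (𝓝 0) ∧
      ∀ g : ℝ × EuclideanSpace ℝ (Fin 3) → ℝ,
        MemLp g 3 (volume.restrict (parabolicCylinder (cc m * R) (0 : ℝ × EuclideanSpace ℝ (Fin 3)))) →
        Tendsto (fun j => ∫ w in parabolicCylinder (cc m * R) (0 : ℝ × EuclideanSpace ℝ (Fin 3)),
            (Pj j) w.1 w.2 * g w) atTop
          (𝓝 (∫ w in parabolicCylinder (cc m * R) (0 : ℝ × EuclideanSpace ℝ (Fin 3)),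
            (πl m) w.1 w.2 * g w)) := fun m R hR => hlev m R hR
  -- ## (C) consecutive levels agree a.e.
  have hstep_cyl : ∀ m (R : ℝ), cc (m + 1) * (R / 2) = cc m * R := by
    intro m R; show (2 : ℝ) ^ (m + 1) * (R / 2) = 2 ^ m * R; rw [pow_succ]; ring
  have hcons_w : ∀ m, ∀ R ∈ Ioo (0 : ℝ) 1,
      ∀ᵐ z ∂(volume.restrict (parabolicCylinder (cc m * R) (0 : ℝ × EuclideanSpace ℝ (Fin 3)))),
        uncurry (wl m) z = uncurry (wl (m + 1)) z := by
    intro m R hR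
    have hR2 : R / 2 ∈ Ioo (0 : ℝ) 1 := ⟨by linarith [hR.1], by linarith [hR.2]⟩
    obtain ⟨-, hm1, -, h1, -⟩ := hlev' m R hR
    obtain ⟨-, hm2, -, h2, -⟩ := hlev' (m + 1) (R / 2) hR2
    rw [hstep_cyl] at h2 hm2
    have ha : 0 < cc m * R := by have := hcc_pos m; have := hR.1; positivity
    exact ae_eq_of_tendsto_eLpNorm_sub (by norm_num) (fun j => hVm j _ ha) hm1.1 hm2.1 h1 h2
  have hcons_π : ∀ m, ∀ R ∈ Ioo (0 : ℝ) 1,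
      ∀ᵐ z ∂(volume.restrict (parabolicCylinder (cc m * R) (0 : ℝ × EuclideanSpace ℝ (Fin 3)))),
        uncurry (πl m) z = uncurry (πl (m + 1)) z := by
    intro m R hR
    have hR2 : R / 2 ∈ Ioo (0 : ℝ) 1 := ⟨by linarith [hR.1], by linarith [hR.2]⟩
    obtain ⟨-, -, hp1, -, h1⟩ := hlev' m R hR
    obtain ⟨-, -, hp2, -, h2⟩ := hlev' (m + 1) (R / 2) hR2
    rw [hstep_cyl] at h2 hp2
    refine ae_eq_of_forall_setIntegral_mul_eq hp1 hp2 fun g hg => ?_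
    exact tendsto_nhds_unique (h1 g hg) (h2 g hg)
  -- iterated consistency
  have hcons_w' : ∀ n m, n ≤ m → ∀ R ∈ Ioo (0 : ℝ) 1,
      ∀ᵐ z ∂(volume.restrict (parabolicCylinder (cc n * R) (0 : ℝ × EuclideanSpace ℝ (Fin 3)))),
        uncurry (wl n) z = uncurry (wl m) z := by
    intro n m hnm R hR
    induction m, hnm using Nat.le_induction with
    | base => exact ae_of_all _ fun z => rfl
    | succ m hnm ih =>
        have hsub : parabolicCylinder (cc n * R) (0 : ℝ × EuclideanSpace ℝ (Fin 3)) ⊆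
            parabolicCylinder (cc m * R) (0 : ℝ × EuclideanSpace ℝ (Fin 3)) :=
          parabolicCylinder_mono (by have := hcc_pos n; have := hR.1; positivity)
            (mul_le_mul_of_nonneg_right (pow_le_pow_right₀ (by norm_num) hnm) hR.1.le) _
        filter_upwards [ih, ae_restrict_of_ae_restrict_of_subset hsub (hcons_w m R hR)] with z h1 h2
        rw [h1, h2]
  have hcons_π' : ∀ n m, n ≤ m → ∀ R ∈ Ioo (0 : ℝ) 1,
      ∀ᵐ z ∂(volume.restrict (parabolicCylinder (cc n * R) (0 : ℝ × EuclideanSpace ℝ (Fin 3)))),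
        uncurry (πl n) z = uncurry (πl m) z := by
    intro n m hnm R hR
    induction m, hnm using Nat.le_induction with
    | base => exact ae_of_all _ fun z => rfl
    | succ m hnm ih =>
        have hsub : parabolicCylinder (cc n * R) (0 : ℝ × EuclideanSpace ℝ (Fin 3)) ⊆
            parabolicCylinder (cc m * R) (0 : ℝ × EuclideanSpace ℝ (Fin 3)) :=
          parabolicCylinder_mono (by have := hcc_pos n; have := hR.1; positivity)
            (mul_le_mul_of_nonneg_right (pow_le_pow_right₀ (by norm_num) hnm) hR.1.le) _
        filter_upwards [ih, ae_restrict_of_ae_restrict_of_subset hsub (hcons_π m R hR)] with z h1 h2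
        rw [h1, h2]
  -- ## (D) gluing along the exhaustion `Q(2ᵐ / 2)`
  set w : ℝ → EuclideanSpace ℝ (Fin 3) → EuclideanSpace ℝ (Fin 3) := fun s y =>
    if hz : ∃ m : ℕ, ((s, y) : ℝ × EuclideanSpace ℝ (Fin 3)) ∈
        parabolicCylinder (cc m / 2) (0 : ℝ × EuclideanSpace ℝ (Fin 3))
    then wl (Nat.find hz) s y else 0 with hw
  set π : ℝ → EuclideanSpace ℝ (Fin 3) → ℝ := fun s y =>
    if hz : ∃ m : ℕ, ((s, y) : ℝ × EuclideanSpace ℝ (Fin 3)) ∈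
        parabolicCylinder (cc m / 2) (0 : ℝ × EuclideanSpace ℝ (Fin 3))
    then πl (Nat.find hz) s y else 0 with hπ
  have hhalf : ∀ m, cc m * (1 / 2) = cc m / 2 := fun m => by ring
  have hw_ae : ∀ m, ∀ᵐ z ∂(volume.restrict (parabolicCylinder (cc m / 2)
      (0 : ℝ × EuclideanSpace ℝ (Fin 3)))), uncurry w z = uncurry (wl m) z := by
    intro m
    have hall : ∀ n, n ≤ m → ∀ᵐ z ∂(volume.restrict (parabolicCylinder (cc m / 2)
        (0 : ℝ × EuclideanSpace ℝ (Fin 3)))),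
        z ∈ parabolicCylinder (cc n / 2) (0 : ℝ × EuclideanSpace ℝ (Fin 3)) →
          uncurry (wl n) z = uncurry (wl m) z := by
      intro n hn
      have h1 := hcons_w' n m hn (1 / 2) (by norm_num)
      rw [hhalf] at h1
      rw [ae_restrict_iff' (isOpen_parabolicCylinder _ _).measurableSet] at h1 ⊢
      filter_upwards [h1] with z hz _ hzn
      exact hz hzn
    have hall' : ∀ᵐ z ∂(volume.restrict (parabolicCylinder (cc m / 2)
        (0 : ℝ × EuclideanSpace ℝ (Fin 3)))), ∀ n ∈ Finset.range (m + 1),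
        z ∈ parabolicCylinder (cc n / 2) (0 : ℝ × EuclideanSpace ℝ (Fin 3)) →
          uncurry (wl n) z = uncurry (wl m) z :=
      (Finset.range (m + 1)).eventually_all.2 fun n hn =>
        hall n (Nat.lt_succ_iff.1 (Finset.mem_range.1 hn))
    filter_upwards [hall', ae_restrict_mem (isOpen_parabolicCylinder _ _).measurableSet] with z hz hzm
    have hex : ∃ n : ℕ, z ∈ parabolicCylinder (cc n / 2) (0 : ℝ × EuclideanSpace ℝ (Fin 3)) :=
      ⟨m, hzm⟩
    have hN : Nat.find hex ≤ m := Nat.find_min' hex hzm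
    have hzN := Nat.find_spec hex
    have e : uncurry w z = uncurry (wl (Nat.find hex)) z := by
      rcases z with ⟨s, y⟩
      show (if hz : ∃ m : ℕ, ((s, y) : ℝ × EuclideanSpace ℝ (Fin 3)) ∈
          parabolicCylinder (cc m / 2) (0 : ℝ × EuclideanSpace ℝ (Fin 3))
        then wl (Nat.find hz) s y else 0) = wl (Nat.find hex) s y
      rw [dif_pos hex]
    rw [e]
    exact hz (Nat.find hex) (Finset.mem_range.2 (Nat.lt_succ_of_le hN)) hzN
  have hπ_ae : ∀ m, ∀ᵐ z ∂(volume.restrict (parabolicCylinder (cc m / 2)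
      (0 : ℝ × EuclideanSpace ℝ (Fin 3)))), uncurry π z = uncurry (πl m) z := by
    intro m
    have hall : ∀ n, n ≤ m → ∀ᵐ z ∂(volume.restrict (parabolicCylinder (cc m / 2)
        (0 : ℝ × EuclideanSpace ℝ (Fin 3)))),
        z ∈ parabolicCylinder (cc n / 2) (0 : ℝ × EuclideanSpace ℝ (Fin 3)) →
          uncurry (πl n) z = uncurry (πl m) z := by
      intro n hn
      have h1 := hcons_π' n m hn (1 / 2) (by norm_num)
      rw [hhalf] at h1
      rw [ae_restrict_iff' (isOpen_parabolicCylinder _ _).measurableSet] at h1 ⊢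
      filter_upwards [h1] with z hz _ hzn
      exact hz hzn
    have hall' : ∀ᵐ z ∂(volume.restrict (parabolicCylinder (cc m / 2)
        (0 : ℝ × EuclideanSpace ℝ (Fin 3)))), ∀ n ∈ Finset.range (m + 1),
        z ∈ parabolicCylinder (cc n / 2) (0 : ℝ × EuclideanSpace ℝ (Fin 3)) →
          uncurry (πl n) z = uncurry (πl m) z :=
      (Finset.range (m + 1)).eventually_all.2 fun n hn =>
        hall n (Nat.lt_succ_iff.1 (Finset.mem_range.1 hn))
    filter_upwards [hall', ae_restrict_mem (isOpen_parabolicCylinder _ _).measurableSet] with z hz hzm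
    have hex : ∃ n : ℕ, z ∈ parabolicCylinder (cc n / 2) (0 : ℝ × EuclideanSpace ℝ (Fin 3)) :=
      ⟨m, hzm⟩
    have hN : Nat.find hex ≤ m := Nat.find_min' hex hzm
    have hzN := Nat.find_spec hex
    have e : uncurry π z = uncurry (πl (Nat.find hex)) z := by
      rcases z with ⟨s, y⟩
      show (if hz : ∃ m : ℕ, ((s, y) : ℝ × EuclideanSpace ℝ (Fin 3)) ∈
          parabolicCylinder (cc m / 2) (0 : ℝ × EuclideanSpace ℝ (Fin 3))
        then πl (Nat.find hz) s y else 0) = πl (Nat.find hex) s y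
      rw [dif_pos hex]
    rw [e]
    exact hz (Nat.find hex) (Finset.mem_range.2 (Nat.lt_succ_of_le hN)) hzN
  -- ## the conclusion on an arbitrary cylinder `Q(a)`
  refine ⟨w, π, fun a ha => ?_⟩
  obtain ⟨m, hm⟩ := pow_unbounded_of_one_lt (2 * a) (by norm_num : (1 : ℝ) < 2)
  have hm' : a < cc m / 2 := by show a < 2 ^ m / 2; linarith
  set R : ℝ := a / cc m with hRdef
  have hR : R ∈ Ioo (0 : ℝ) 1 := by
    refine ⟨div_pos ha (hcc_pos m), ?_⟩
    rw [hRdef, div_lt_one (hcc_pos m)]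
    linarith [hcc_pos m]
  have hcR : cc m * R = a := by rw [hRdef, mul_div_cancel₀ a (hcc_pos m).ne']
  have hsubQ : parabolicCylinder a (0 : ℝ × EuclideanSpace ℝ (Fin 3)) ⊆
      parabolicCylinder (cc m / 2) (0 : ℝ × EuclideanSpace ℝ (Fin 3)) :=
    parabolicCylinder_mono ha.le hm'.le _
  have hw_a : ∀ᵐ z ∂(volume.restrict (parabolicCylinder a (0 : ℝ × EuclideanSpace ℝ (Fin 3)))),
      uncurry (wl m) z = uncurry w z := by
    filter_upwards [ae_restrict_of_ae_restrict_of_subset hsubQ (hw_ae m)] with z hz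
    exact hz.symm
  have hπ_a : ∀ᵐ z ∂(volume.restrict (parabolicCylinder a (0 : ℝ × EuclideanSpace ℝ (Fin 3)))),
      uncurry (πl m) z = uncurry π z := by
    filter_upwards [ae_restrict_of_ae_restrict_of_subset hsubQ (hπ_ae m)] with z hz
    exact hz.symm
  obtain ⟨h1, h2, -, h3, h4⟩ := hlev' m R hR
  rw [hcR] at h1 h2 h3 h4
  refine ⟨h1.congr_ae' hw_a hπ_a, h2.ae_eq hw_a, ?_, ?_⟩
  · -- strong convergence of the velocities
    refine (tendsto_congr fun j => ?_).1 h3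
    refine eLpNorm_congr_ae ?_
    filter_upwards [hw_a] with z hz
    show uncurry (V j) z - uncurry (wl m) z = uncurry (V j) z - uncurry w z
    rw [hz]
  · -- weak convergence of the pressures
    intro g hg
    have h5 := h4 g hg
    have e : ∫ w' in parabolicCylinder a (0 : ℝ × EuclideanSpace ℝ (Fin 3)), (πl m) w'.1 w'.2 * g w' =
        ∫ w' in parabolicCylinder a (0 : ℝ × EuclideanSpace ℝ (Fin 3)), π w'.1 w'.2 * g w' := by
      refine integral_congr_ae ?_
      filter_upwards [hπ_a] with z hz
      change (πl m) z.1 z.2 = π z.1 z.2 at hz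
      rw [hz]
    rw [e] at h5
    exact h5

end Summit.NavierStokesRegularity.NavierStokesRegularity.Theorems.TypeITraceScarL3

end
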